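import Summits.QuantumFields.BalabanUV.T4Continuum.Support.NE7StraightDefectAssemblyV2
import Summits.QuantumFields.BalabanUV.T4Continuum.Support.NE7SmoothProductCutoff
import Summits.QuantumFields.BalabanUV.T4Continuum.Support.NE7TorusRoadGeometry
import Summits.QuantumFields.BalabanUV.T4Continuum.Support.NE7CoarseSplitAssembly
import Summits.QuantumFields.BalabanUV.T4Continuum.Support.NE7CoarseCurvatureLetterLocal
import Summits.QuantumFields.BalabanUV.T4Continuum.Support.NE7TanCriticalGauge
import HarnessLib

/-!
# NE7TorusRoadDefectClause — CLAUSE (C3) OF THE v4 BUNDLE FROM A LOCAL CHART: the two-region criticality defect of `e^{χ•Ã}` on straight tangents with the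
# closed-form densities `τn = r·(Ma₀)·C_c·K_d∕M³ + ρ(a₀,a₁) + ρ(a₀,a₁ + a₀∕M)`, `τf = τn + r·C_c∕M³ + 2#Plane(2a₁∕M + 2a₀∕M²)` on F263's near∕far regions (file F278a)

Cell `pub-balaban`, rung (B)+1 sub-cell t4, lineage `b2b-balaban-t4-ne7-p1` (CRUX PROVER NE7 #1 = OWNER of row NE7), generation 90; memo
`t4/b2b-balaban-t4-ne7-p1-g90/DEFECT-FAR.md` §4 (instantiation I3 of the torus road).  Over F275 `NE7StraightDefectAssemblyV2`, F276 `NE7SmoothProductCutoff`, F277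
`NE7TorusRoadGeometry`, F272 `NE7CoarseSplitAssembly`, F259 `NE7CoarseCurvatureLetterLocal.coarseCurl_le_of_agree`, `NE7TanCriticalGauge.tanCritical_gaugeAct`,
`NE7CoarseCurvatureLetter.smallField_cavgIter_gaugeAct`.

WHY (memo §4).  F263 `NE7ApeOfTorusRoadV4.hape_of_torusRoadV4` reduces `hape` to a per-plaquette bundle (chart letters, split, two-region defect on straight
tangents, gauge matching, numeric line).  The bundle is discharged from ONE local input — a chart `(u, Ã)` of `U` around the plaquette with `U^u = e^{Ã}` on the
torus ball `|y − z|_{T(MN)} ≤ (nbRad + 2ℓ + 10)·M` and global letters `‖Ã‖ ≤ a₀`, `‖δÃ‖ ≤ a₁` (the shape of [B8] Thm 2 at `U₀ = 1` on nested cubes, (N1)-weak) —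
through the cut-off representative `A = χ•Ã` (`χ` = F276's product cutoff at site scale `M`, plateau radius `ρ₁ = (nbRad + 2ℓ + 6)M`), with constants in closed form.
WHAT ([folklore] composition; 0 def, 0 sorry; dimension `d + 1`, `L ≥ 2`).  **`defect_clause_of_chart`**: F275 at `U′ = U^u`, `S x :⟺ ℓ ≤ |⌊x∕M⌋ − blk z|_{T(N)}`, with
the geometry of F277 (variation zone of `χ` and its neighbours far; slabs `χ`-constant or far; agreement radii) and the scaling identity
`(M^{d+1}∕M²)·(L∕L^{d+1})^{k+1} = 1∕M` that turns F275's `c_R·C₅₁`, `c_R·q^{k+1}` into `r(Ma₀)C_cK_d∕M³`, `rC_c∕M³`.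
HONEST FRAMING (page 1): composition BY NAME of tree theorems over the chart HYPOTHESIS ((N1)-weak is NOT proved here); nothing of Bałaban's asserted; NOT (APE),
NOT ONE-STEP, NOT NE7; spine 0∕9; finite T⁴ rung (B)+1 — NOT infinite volume, NOT mass gap, NOT `BetaPertH`, NOT Clay.  Continuum YM on T⁴ ⇐ BetaPertH ∧ nine
spine estimates (0/9 proved); BetaPertH ⇐ (D1) ∧ (D4) ∧ CAP+tail; G-an2-4 gates asym, D1 and NE2/3/4.
-/

set_option autoImplicit false

open scoped BigOperators Matrix.Norms.L2Operator
open NormedSpace Finset Set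

namespace Summit.QuantumFields.BalabanUV.T4Continuum.NE7TorusRoadDefectClause

open Literature.MathematicalPhysics.QuantumFieldTheory.Balaban1983to89
open B7Prop1Explicit B7Prop2Explicit MatrixLog UnitaryModel
open B4ContourShift (supNorm supNorm_nonneg)
open B4TorusKernel.MultiPeriod (circAbs torusSupNorm translate torusSupNorm_translate circAbs_nonneg torusSupNorm_nonneg)
open T4AveragingDeficitWall (IsUnitaryCfg IsSkewDir SmallField vary curlAt dirL1 flat_mem_classes)
open T4AveragingDeficitWallBoundary (IsPeriodicCfg periodBox)
open AveragingDeficitPeriodicCounting (IsPeriodicDir)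
open AveragingDeficitMultiLevelPrep (LevelSmall TangentIter cavgIter)
open AveragingDeficitKDatum (isUnitaryCfg_gaugeAct)
open BlockAverageVaryHolo (nbRad)
open BlockAverageVaryDisc (rho0)
open BlockAverageCurrent (smallField_gaugeAct)
open MinimalActionLevels (perWin)
open NE3HessForm (dAction)
open BlockAveragePushDirSplit (flat)
open NE3TangentFlatStructure (Qcoarse)
open NE3TangentCovariantTower (dirIter tangentIter_iff_dirIter_eq_zero cavgIter_flat)
open NE3LinearisedAverageSup (curvSum)
open NE3QbarIterCovLiftPrep (cruxC)
open NE3RightInverseSolveLetters (thetaLoc)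
open NE3HatInvCurlLetters (curl1C curl1C_nonneg)
open NE3QuadRemainderLocality (depRad)
open NE3SmoothLiftW (isPeriodicCfg_gaugeAct)
open NE3SmoothLiftCurl (curlAt_flat_eq)
open NE3EnergyShapes (IsUnitarySite)
open B5Prop11Plancherel (Tor fine)
open B5Blocks16 (blockOf)
open B6LowerBound2153Torus (toT rep)
open NE7CoarseCurvatureLetter (levelSmall_zero curvSum_zero smallField_cavgIter_gaugeAct)
open NE7CoarseCurvatureLetterLocal (coarseCurl_le_of_agree)
open NE7CoarseSplitAssembly (exists_coarse_split)
open NE7TanCriticalGauge (tanCritical_gaugeAct)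
open NE7StraightDefectAssemblyV2 (abs_dAction_cutoffRep_le_twoRegion_straight)
open NE7SmoothProductCutoff (exists_smooth_cutoff)
open NE7CentredRepresentative (supNorm_add_e_le)
open NE7TorusRoadGeometry (depRad_succ_le tsn_fine_le_of_block_le le_tsn_block_of_le_fine tsn_fine_add_e_le le_tsn_fine_add_e tsn_fine_le_of_slab
  tsn_fine_le_of_l1_ball rep_blockOf_toT_eq tsn_fine_emod)

noncomputable section

variable {d : ℕ} {n : Type*} [Fintype n] [DecidableEq n]

/-- (C3) OF THE BUNDLE FROM THE CHART AND A GIVEN CUTOFF: the two-region defect of `e^{χ•Ã}` on straight tangents with the closed-form densities (F275 + the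
scaling identity `(M^(d+1)∕M²)·(L∕L^(d+1))^(k+1) = 1∕M`). [folklore] -/
theorem defect_clause_of_chart [Nonempty n] {L : ℕ} [NeZero L] (hL : 2 ≤ L) (k : ℕ) {N ℓ : ℕ} [NeZero N] (hℓ : 1 ≤ ℓ)
    -- the class radius `ε∕M²` (multi-level smallness) and the current radius `r∕M²`
    {ε r : ℝ} (hε : 0 ≤ ε) (hLS : LevelSmall (d + 1) L k (ε / ((L : ℝ) ^ (k + 1)) ^ 2))
    (hθ : cruxC (d + 1) L * ε < 1) (hθl : thetaLoc (d + 1) L * ε < 1) (hε1 : ε ≤ 1) (hr : 0 ≤ r)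
    -- the configuration: unitary, periodic, in the class, tangent-critical, with datum `D` of plaquette radius `β′`
    {U : Site (d + 1) → Fin (d + 1) → (Matrix n n ℂ)ˣ} (hUu : IsUnitaryCfg U) (hUP : IsPeriodicCfg U ((N * L ^ (k + 1) : ℕ) : ℤ))
    (hUε : SmallField U (ε / ((L : ℝ) ^ (k + 1)) ^ 2)) (hUr : SmallField U (r / ((L : ℝ) ^ (k + 1)) ^ 2))
    (hcrit : ∀ φ : Site (d + 1) → Fin (d + 1) → Matrix n n ℂ, IsSkewDir φ → IsPeriodicDir φ ((N * L ^ (k + 1) : ℕ) : ℤ) → TangentIter L k U φ →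
      dAction U φ (perWin (d + 1) (N * L ^ (k + 1))) = 0)
    -- the plaquette and the chart around it
    (z : Site (d + 1))
    {u : Site (d + 1) → (Matrix n n ℂ)ˣ} (hu : IsUnitarySite u) (huP : ∀ (y : Site (d + 1)) (i : Fin (d + 1)), u (y + ((N * L ^ (k + 1) : ℕ) : ℤ) • e i) = u y)
    {At : Site (d + 1) → Fin (d + 1) → Matrix n n ℂ} (hAt : IsSkewDir At) (hAtP : IsPeriodicDir At ((N * L ^ (k + 1) : ℕ) : ℤ))
    {a₀ a₁ : ℝ} (ha₀ : 0 ≤ a₀) (ha₁ : 0 ≤ a₁) (hAtα : ∀ (y : Site (d + 1)) (κ : Fin (d + 1)), ‖At y κ‖ ≤ a₀)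
    (hAt1 : ∀ (y : Site (d + 1)) (κ τ : Fin (d + 1)), ‖At (y + e τ) κ - At y κ‖ ≤ a₁)
    (hagree : ∀ (y : Site (d + 1)) (κ : Fin (d + 1)),
      torusSupNorm (fun _ : Fin (d + 1) => L ^ (k + 1) * N) (y - z) ≤ (((nbRad (d + 1) L + 2 * ℓ + 10) * L ^ (k + 1) : ℕ) : ℝ) →
        gaugeAct u U y κ = vary (flat (d := d + 1) (n := n)) At 1 y κ)
    -- F51 ∕ F259 smallness of `M·a₀`
    (hσ : 4 * (3 + 12 * ((d + 1 : ℕ) : ℝ)) ^ 2 * (L : ℝ) ^ (k + 1) * a₀ ≤ rho0 (d + 1) L ^ 2)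
    (hS1 : (8 * (3 + 12 * ((d + 1 : ℕ) : ℝ)) * (2 + 2 * ((((d + 1 : ℕ) : ℝ) + 1) * L)
        * (1 + ((1250 * ((nbRad (d + 1) L : ℝ) + L) + 8 * (((d + 1 : ℕ) : ℝ) * L) + 2 * L) * (((d + 1 : ℕ) : ℝ) * (2 * nbRad (d + 1) L + 1) ^ (d + 1)))
          / ((L : ℝ) / (L : ℝ) ^ (d + 1))))) * ((L : ℝ) ^ (k + 1) * a₀) ≤ 1)
    (hb : 256 * (((d + 1 : ℕ) : ℝ) + 1) * L * (3 + 12 * ((d + 1 : ℕ) : ℝ)) * ((L : ℝ) ^ (k + 1) * a₀) ≤ 1)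
    -- the cutoff (F276's, supplied by the caller) and the plateau radius
    (χ : Site (d + 1) → ℝ) (hχP : ∀ (y : Site (d + 1)) (i : Fin (d + 1)), χ (y + ((L ^ (k + 1) * N : ℕ) : ℤ) • e i) = χ y)
    (hχ01 : ∀ y : Site (d + 1), 0 ≤ χ y ∧ χ y ≤ 1)
    (hc1 : ∀ (y : Site (d + 1)) (κ : Fin (d + 1)), |χ (y + e κ) - χ y| ≤ 1 / (L : ℝ) ^ (k + 1))
    (hc2 : ∀ (y : Site (d + 1)) (κ τ : Fin (d + 1)), |(χ (y + e κ) - χ y) - (χ (y - e τ + e κ) - χ (y - e τ))| ≤ 2 / ((L : ℝ) ^ (k + 1)) ^ 2)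
    {ρ₁ : ℕ} (hρ₁ : ρ₁ = (nbRad (d + 1) L + 2 * ℓ + 6) * L ^ (k + 1))
    (hplat : ∀ y : Site (d + 1), torusSupNorm (fun _ : Fin (d + 1) => L ^ (k + 1) * N) (y - z) ≤ ρ₁ → χ y = 1)
    (hzero : ∀ y : Site (d + 1), (ρ₁ : ℝ) + 2 * (L : ℝ) ^ (k + 1) - 1 ≤ torusSupNorm (fun _ : Fin (d + 1) => L ^ (k + 1) * N) (y - z) →
      χ y = 0) :
      (∀ Y : Site (d + 1) → Fin (d + 1) → Matrix n n ℂ, IsSkewDir Y → IsPeriodicDir Y ((N * L ^ (k + 1) : ℕ) : ℤ) →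
        (Qcoarse L)^[k + 1] Y = 0 →
        |dAction (vary (flat (d := d + 1) (n := n)) (fun y κ => χ y • At y κ) 1) Y (perWin (d + 1) (N * L ^ (k + 1)))|
          ≤ (r * ((L : ℝ) ^ (k + 1) * a₀) * ((curl1C (d + 1) L / (1 - thetaLoc (d + 1) L * ε))
                * (2 * (8 * (3 + 12 * ((d + 1 : ℕ) : ℝ)) * (2 + 2 * ((((d + 1 : ℕ) : ℝ) + 1) * L)
                  * (1 + ((1250 * ((nbRad (d + 1) L : ℝ) + L) + 8 * (((d + 1 : ℕ) : ℝ) * L) + 2 * L)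
                      * (((d + 1 : ℕ) : ℝ) * (2 * nbRad (d + 1) L + 1) ^ (d + 1))) / ((L : ℝ) / (L : ℝ) ^ (d + 1)))))))
              / ((L : ℝ) ^ (k + 1)) ^ 3
            + ((Fintype.card (T4AveragingDeficitWall.Plane (d + 1)) : ℝ)
              * (2 * (8 * a₀ * (2 * a₁ + 28 * a₀ ^ 2) + 6 * (Real.exp a₀ - 1) * (2 * a₁ + 24 * (Real.exp a₀ - 1) * a₀)
                  + (2 * a₁ + 24 * (Real.exp a₀ - 1) * a₀) * (2 * a₁ + 28 * a₀ ^ 2) + 960 * (Real.exp a₀ - 1) * a₀ ^ 2)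
                + 64 * a₀ * a₁))
            + ((Fintype.card (T4AveragingDeficitWall.Plane (d + 1)) : ℝ)
              * (2 * (8 * a₀ * (2 * (a₁ + 1 / (L : ℝ) ^ (k + 1) * a₀) + 28 * a₀ ^ 2)
                  + 6 * (Real.exp a₀ - 1) * (2 * (a₁ + 1 / (L : ℝ) ^ (k + 1) * a₀) + 24 * (Real.exp a₀ - 1) * a₀)
                  + (2 * (a₁ + 1 / (L : ℝ) ^ (k + 1) * a₀) + 24 * (Real.exp a₀ - 1) * a₀) * (2 * (a₁ + 1 / (L : ℝ) ^ (k + 1) * a₀) + 28 * a₀ ^ 2)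
                  + 960 * (Real.exp a₀ - 1) * a₀ ^ 2)
                + 64 * a₀ * (a₁ + 1 / (L : ℝ) ^ (k + 1) * a₀))))
            * dirL1 Y ((periodBox (d := d + 1) (N * L ^ (k + 1))).filter (fun x => ¬ (ℓ
                ≤ torusSupNorm (fun _ : Fin (d + 1) => N) ((fun i => x i / ((L ^ (k + 1) : ℕ) : ℤ))
                    - rep (fun _ : Fin (d + 1) => N) (B5Blocks16.blockOf (L ^ (k + 1)) (fun _ : Fin (d + 1) => N)
                        (toT (fine (L ^ (k + 1)) (fun _ : Fin (d + 1) => N)) z))))))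
          + ((r * ((L : ℝ) ^ (k + 1) * a₀) * ((curl1C (d + 1) L / (1 - thetaLoc (d + 1) L * ε))
                * (2 * (8 * (3 + 12 * ((d + 1 : ℕ) : ℝ)) * (2 + 2 * ((((d + 1 : ℕ) : ℝ) + 1) * L)
                  * (1 + ((1250 * ((nbRad (d + 1) L : ℝ) + L) + 8 * (((d + 1 : ℕ) : ℝ) * L) + 2 * L)
                      * (((d + 1 : ℕ) : ℝ) * (2 * nbRad (d + 1) L + 1) ^ (d + 1))) / ((L : ℝ) / (L : ℝ) ^ (d + 1)))))))
              / ((L : ℝ) ^ (k + 1)) ^ 3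
            + ((Fintype.card (T4AveragingDeficitWall.Plane (d + 1)) : ℝ)
              * (2 * (8 * a₀ * (2 * a₁ + 28 * a₀ ^ 2) + 6 * (Real.exp a₀ - 1) * (2 * a₁ + 24 * (Real.exp a₀ - 1) * a₀)
                  + (2 * a₁ + 24 * (Real.exp a₀ - 1) * a₀) * (2 * a₁ + 28 * a₀ ^ 2) + 960 * (Real.exp a₀ - 1) * a₀ ^ 2)
                + 64 * a₀ * a₁))
            + ((Fintype.card (T4AveragingDeficitWall.Plane (d + 1)) : ℝ)
              * (2 * (8 * a₀ * (2 * (a₁ + 1 / (L : ℝ) ^ (k + 1) * a₀) + 28 * a₀ ^ 2)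
                  + 6 * (Real.exp a₀ - 1) * (2 * (a₁ + 1 / (L : ℝ) ^ (k + 1) * a₀) + 24 * (Real.exp a₀ - 1) * a₀)
                  + (2 * (a₁ + 1 / (L : ℝ) ^ (k + 1) * a₀) + 24 * (Real.exp a₀ - 1) * a₀) * (2 * (a₁ + 1 / (L : ℝ) ^ (k + 1) * a₀) + 28 * a₀ ^ 2)
                  + 960 * (Real.exp a₀ - 1) * a₀ ^ 2)
                + 64 * a₀ * (a₁ + 1 / (L : ℝ) ^ (k + 1) * a₀))))
            + r * (curl1C (d + 1) L / (1 - thetaLoc (d + 1) L * ε)) / ((L : ℝ) ^ (k + 1)) ^ 3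
            + 2 * (Fintype.card (T4AveragingDeficitWall.Plane (d + 1)) : ℝ)
              * (2 * (1 / (L : ℝ) ^ (k + 1)) * a₁ + 2 / ((L : ℝ) ^ (k + 1)) ^ 2 * a₀))
            * dirL1 Y ((periodBox (d := d + 1) (N * L ^ (k + 1))).filter (fun x => ℓ
                ≤ torusSupNorm (fun _ : Fin (d + 1) => N) ((fun i => x i / ((L ^ (k + 1) : ℕ) : ℤ))
                    - rep (fun _ : Fin (d + 1) => N) (B5Blocks16.blockOf (L ^ (k + 1)) (fun _ : Fin (d + 1) => N)
                        (toT (fine (L ^ (k + 1)) (fun _ : Fin (d + 1) => N)) z)))))) := by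
  /- §0 numerals -/
  have hL1 : 1 ≤ L := by omega
  have hM1 : 1 ≤ L ^ (k + 1) := Nat.one_le_iff_ne_zero.mpr (pow_ne_zero _ (by omega))
  have hN1 : 1 ≤ N := Nat.one_le_iff_ne_zero.mpr (NeZero.ne N)
  have hMr : ((L ^ (k + 1) : ℕ) : ℝ) = (L : ℝ) ^ (k + 1) := by push_cast; ring
  have hMz : ((L ^ (k + 1) : ℕ) : ℤ) = (L : ℤ) ^ (k + 1) := by push_cast; ring
  have hMpos : (0 : ℝ) < (L : ℝ) ^ (k + 1) := by positivity
  have hMge1 : (1 : ℝ) ≤ (L : ℝ) ^ (k + 1) := by rw [← hMr]; exact_mod_cast hM1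
  have hmc : N * L ^ (k + 1) = L ^ (k + 1) * N := Nat.mul_comm _ _
  have hP1 : 1 ≤ L ^ (k + 1) * N := Nat.one_le_iff_ne_zero.mpr (Nat.mul_ne_zero (pow_ne_zero _ (by omega)) (NeZero.ne N))
  haveI hPnz : NeZero (L ^ (k + 1) * N) := ⟨by omega⟩
  have hnb0 : (0 : ℝ) ≤ (nbRad (d + 1) L : ℝ) := by positivity
  have hℓ1 : (1 : ℝ) ≤ ℓ := by exact_mod_cast hℓ
  -- the plateau radius `ρ₁ = (nb + 2ℓ + 6)M` (sites); the agreement radius is `ρ₁ + 4M`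
  have hρ₁r : (ρ₁ : ℝ) = ((nbRad (d + 1) L : ℝ) + 2 * ℓ + 6) * (L : ℝ) ^ (k + 1) := by rw [hρ₁]; push_cast; ring
  have hRs : (((nbRad (d + 1) L + 2 * ℓ + 10) * L ^ (k + 1) : ℕ) : ℝ) = (ρ₁ : ℝ) + 4 * (L : ℝ) ^ (k + 1) := by
    rw [hρ₁r]; push_cast; ring
  -- the block of `z` on the coarse torus and the reduced corner `z′`
  set c : Site (d + 1) := rep (fun _ : Fin (d + 1) => N) (B5Blocks16.blockOf (L ^ (k + 1)) (fun _ : Fin (d + 1) => N)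
      (toT (fine (L ^ (k + 1)) (fun _ : Fin (d + 1) => N)) z)) with hc
  have hcz : c = fun i => (z i % ((L ^ (k + 1) * N : ℕ) : ℤ)) / ((L ^ (k + 1) : ℕ) : ℤ) := by rw [hc, rep_blockOf_toT_eq]
  obtain ⟨z', hz'⟩ : ∃ z' : Site (d + 1), z' = fun i => z i % ((L ^ (k + 1) * N : ℕ) : ℤ) := ⟨_, rfl⟩
  have hz'c : ∀ i, 0 ≤ z' i - ((L ^ (k + 1) : ℕ) : ℤ) * c i ∧ z' i - ((L ^ (k + 1) : ℕ) : ℤ) * c i ≤ ((L ^ (k + 1) : ℕ) : ℤ) - 1 := by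
    intro i
    have hM0 : (0 : ℤ) < ((L ^ (k + 1) : ℕ) : ℤ) := by exact_mod_cast (by omega : 0 < L ^ (k + 1))
    have e1 : z' i - ((L ^ (k + 1) : ℕ) : ℤ) * c i = z' i % ((L ^ (k + 1) : ℕ) : ℤ) := by
      rw [hcz, hz']
      have := Int.mul_ediv_add_emod (z i % ((L ^ (k + 1) * N : ℕ) : ℤ)) ((L ^ (k + 1) : ℕ) : ℤ)
      linarith
    rw [e1]
    exact ⟨Int.emod_nonneg _ hM0.ne', by have := Int.emod_lt_of_pos (z' i) hM0; omega⟩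
  have htsnz' : ∀ x : Site (d + 1), torusSupNorm (fun _ : Fin (d + 1) => L ^ (k + 1) * N) (x - z')
      = torusSupNorm (fun _ : Fin (d + 1) => L ^ (k + 1) * N) (x - z) := fun x => by rw [hz']; exact tsn_fine_emod (L ^ (k + 1)) N x z
  /- §1 the gauge-fixed configuration `U′ = U^u` -/
  set U' : Site (d + 1) → Fin (d + 1) → (Matrix n n ℂ)ˣ := gaugeAct u U with hU'
  have hU'u : IsUnitaryCfg U' := isUnitaryCfg_gaugeAct hu hUu
  have hUP' : IsPeriodicCfg U ((L ^ (k + 1) * N : ℕ) : ℤ) := by rw [← hmc]; exact hUP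
  have huP' : ∀ (y : Site (d + 1)) (i : Fin (d + 1)), u (y + ((L ^ (k + 1) * N : ℕ) : ℤ) • e i) = u y := by rw [← hmc]; exact huP
  have hU'P : IsPeriodicCfg U' ((L ^ (k + 1) * N : ℕ) : ℤ) := isPeriodicCfg_gaugeAct huP' hUP'
  have hU'ε : SmallField U' (ε / ((L : ℝ) ^ (k + 1)) ^ 2) := smallField_gaugeAct hu hUε
  have hU'r : SmallField U' (r / ((L : ℝ) ^ (k + 1)) ^ 2) := smallField_gaugeAct hu hUr
  have hx0 : 0 ≤ ε / ((L : ℝ) ^ (k + 1)) ^ 2 := by positivity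
  have ha0 : 0 ≤ r / ((L : ℝ) ^ (k + 1)) ^ 2 := by positivity
  have hxM : ((L : ℝ) ^ (k + 1)) ^ 2 * (ε / ((L : ℝ) ^ (k + 1)) ^ 2) = ε := by field_simp
  have hθ' : cruxC (d + 1) L * (((L : ℝ) ^ (k + 1)) ^ 2 * (ε / ((L : ℝ) ^ (k + 1)) ^ 2)) < 1 := by rw [hxM]; exact hθ
  have hθl' : thetaLoc (d + 1) L * (((L : ℝ) ^ (k + 1)) ^ 2 * (ε / ((L : ℝ) ^ (k + 1)) ^ 2)) < 1 := by rw [hxM]; exact hθl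
  have hε1' : ((L : ℝ) ^ (k + 1)) ^ 2 * (ε / ((L : ℝ) ^ (k + 1)) ^ 2) ≤ 1 := by rw [hxM]; exact hε1
  -- tangent-criticality of `U` in `dirIter` form, transported to `U′`
  have hcritU : ∀ φ : Site (d + 1) → Fin (d + 1) → Matrix n n ℂ, IsSkewDir φ → IsPeriodicDir φ ((L ^ (k + 1) * N : ℕ) : ℤ) →
      dirIter L (k + 1) U φ = 0 → dAction U φ (perWin (d + 1) (L ^ (k + 1) * N)) = 0 := by
    intro φ hφ hφP hφT
    rw [← hmc] at hφP ⊢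
    exact hcrit φ hφ hφP ((tangentIter_iff_dirIter_eq_zero L k U φ).mpr hφT)
  have hcrit' := tanCritical_gaugeAct hL1 k hUu hx0 hLS hUε hu huP' hcritU
  -- where `χ` varies along a bond, the base site is in the annulus `ρ₁ − 1 < |y − z|_T < ρ₁ + 2M − 1`
  have hvar : ∀ (y : Site (d + 1)) (κ : Fin (d + 1)), χ (y + e κ) ≠ χ y →
      (ρ₁ : ℝ) - 1 < torusSupNorm (fun _ : Fin (d + 1) => L ^ (k + 1) * N) (y - z)
        ∧ torusSupNorm (fun _ : Fin (d + 1) => L ^ (k + 1) * N) (y - z) < (ρ₁ : ℝ) + 2 * (L : ℝ) ^ (k + 1) := by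
    intro y κ hne
    constructor
    · by_contra hle
      push Not at hle
      have h1 : χ y = 1 := hplat y (by linarith)
      have h2 : χ (y + e κ) = 1 := hplat (y + e κ) ((tsn_fine_add_e_le (L ^ (k + 1) * N) y z κ).trans (by linarith))
      exact hne (by rw [h1, h2])
    · by_contra hle
      push Not at hle
      have h1 : χ y = 0 := hzero y (by linarith)
      have h2 : χ (y + e κ) = 0 := hzero (y + e κ) (by have := le_tsn_fine_add_e (L ^ (k + 1) * N) y z κ; linarith)
      exact hne (by rw [h1, h2])
  have hχne : ∀ y : Site (d + 1), χ y ≠ 0 → torusSupNorm (fun _ : Fin (d + 1) => L ^ (k + 1) * N) (y - z) < (ρ₁ : ℝ) + 2 * (L : ℝ) ^ (k + 1) - 1 := by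
    intro y hy
    by_contra hle
    push Not at hle
    exact hy (hzero y hle)
  /- §3 the cut-off representative `A = χ•Ã` and its letters -/
  set A : Site (d + 1) → Fin (d + 1) → Matrix n n ℂ := fun y κ => χ y • At y κ with hA
  have hAs : IsSkewDir A := fun y κ => skewAdjoint.smul_mem (χ y) (hAt y κ)
  have hAtP' : IsPeriodicDir At ((L ^ (k + 1) * N : ℕ) : ℤ) := by rw [← hmc]; exact hAtP
  have hAP' : IsPeriodicDir A ((L ^ (k + 1) * N : ℕ) : ℤ) := fun y i κ => by simp only [hA, hχP y i, hAtP' y i κ]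
  have hAP : IsPeriodicDir A ((N * L ^ (k + 1) : ℕ) : ℤ) := by rw [hmc]; exact hAP'
  have hχabs : ∀ y, |χ y| ≤ 1 := fun y => abs_le.mpr ⟨by linarith [(hχ01 y).1], (hχ01 y).2⟩
  have hAα : ∀ (y : Site (d + 1)) (κ : Fin (d + 1)), ‖A y κ‖ ≤ a₀ := by
    intro y κ
    show ‖χ y • At y κ‖ ≤ a₀
    rw [norm_smul, Real.norm_eq_abs]
    calc |χ y| * ‖At y κ‖ ≤ 1 * a₀ := mul_le_mul (hχabs y) (hAtα y κ) (norm_nonneg _) zero_le_one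
      _ = a₀ := one_mul _
  have hc₁0 : (0 : ℝ) ≤ 1 / (L : ℝ) ^ (k + 1) := by positivity
  have hc₂0 : (0 : ℝ) ≤ 2 / ((L : ℝ) ^ (k + 1)) ^ 2 := by positivity
  have hα₁' : 0 ≤ a₁ + 1 / (L : ℝ) ^ (k + 1) * a₀ := by positivity
  have hA1 : ∀ (y : Site (d + 1)) (κ τ : Fin (d + 1)), ‖A (y + e τ) κ - A y κ‖ ≤ a₁ + 1 / (L : ℝ) ^ (k + 1) * a₀ := by
    intro y κ τ
    show ‖χ (y + e τ) • At (y + e τ) κ - χ y • At y κ‖ ≤ _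
    have e1 : χ (y + e τ) • At (y + e τ) κ - χ y • At y κ = χ (y + e τ) • (At (y + e τ) κ - At y κ) + (χ (y + e τ) - χ y) • At y κ := by
      simp only [smul_sub, sub_smul]; abel
    rw [e1]
    refine (norm_add_le _ _).trans (add_le_add ?_ ?_)
    · rw [norm_smul, Real.norm_eq_abs]
      calc |χ (y + e τ)| * ‖At (y + e τ) κ - At y κ‖ ≤ 1 * a₁ := mul_le_mul (hχabs _) (hAt1 y κ τ) (norm_nonneg _) zero_le_one
        _ = a₁ := one_mul _
    · rw [norm_smul, Real.norm_eq_abs]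
      exact mul_le_mul (hc1 y τ) (hAtα y κ) (norm_nonneg _) hc₁0
  -- where `χ = 1`, `e^{A} = e^{Ã}`
  have hvaryA : ∀ (y : Site (d + 1)) (κ : Fin (d + 1)), χ y = 1 →
      vary (flat (d := d + 1) (n := n)) A 1 y κ = vary (flat (d := d + 1) (n := n)) At 1 y κ := by
    intro y κ hy
    show (flat (d := d + 1) (n := n)) y κ * expUnit (((1 : ℝ) : ℂ) • (χ y • At y κ))
      = (flat (d := d + 1) (n := n)) y κ * expUnit (((1 : ℝ) : ℂ) • At y κ)
    rw [hy, one_smul]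
  -- agreement: `U′ = e^{Ã}` on the chart ball, `e^{A} = U′` on the plateau
  have hagreeAt : ∀ (y : Site (d + 1)) (κ : Fin (d + 1)),
      torusSupNorm (fun _ : Fin (d + 1) => L ^ (k + 1) * N) (y - z) ≤ (ρ₁ : ℝ) + 4 * (L : ℝ) ^ (k + 1) →
      U' y κ = vary (flat (d := d + 1) (n := n)) At 1 y κ := by
    intro y κ hy
    exact hagree y κ (by rw [hRs]; exact hy)
  have hagreeA : ∀ (y : Site (d + 1)) (κ : Fin (d + 1)), torusSupNorm (fun _ : Fin (d + 1) => L ^ (k + 1) * N) (y - z) ≤ ρ₁ →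
      vary (flat (d := d + 1) (n := n)) A 1 y κ = U' y κ := by
    intro y κ hy
    rw [hvaryA y κ (hplat y hy), hagreeAt y κ (by linarith [hMpos.le])]
  /- §5 (C3) the two-region defect through F275, far set `S x :⟺ ℓ ≤ |⌊x∕M⌋ − c|_{T(N)}` -/
  -- `S` is `MN`-periodic
  have hSP : ∀ (y : Site (d + 1)) (i : Fin (d + 1)), ((ℓ : ℝ) ≤ torusSupNorm (fun _ : Fin (d + 1) => N) ((fun j => (y + ((L ^ (k + 1) * N : ℕ) : ℤ) • e i) j / ((L ^ (k + 1) : ℕ) : ℤ)) - c)) ↔ ((ℓ : ℝ) ≤ torusSupNorm (fun _ : Fin (d + 1) => N) ((fun j => y j / ((L ^ (k + 1) : ℕ) : ℤ)) - c)) := by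
    intro y i
    have hM0 : ((L ^ (k + 1) : ℕ) : ℤ) ≠ 0 := by exact_mod_cast (by omega : L ^ (k + 1) ≠ 0)
    have e1 : ((fun j => (y + ((L ^ (k + 1) * N : ℕ) : ℤ) • e i) j / ((L ^ (k + 1) : ℕ) : ℤ)) - c)
        = translate (fun _ : Fin (d + 1) => N) ((fun j => y j / ((L ^ (k + 1) : ℕ) : ℤ)) - c) (e i) := by
      funext j
      simp only [Pi.sub_apply, Pi.add_apply, Pi.smul_apply, B4TorusKernel.MultiPeriod.translate_apply, smul_eq_mul]
      rw [show y j + ((L ^ (k + 1) * N : ℕ) : ℤ) * e i j = y j + ((N : ℤ) * e i j) * ((L ^ (k + 1) : ℕ) : ℤ) by push_cast; ring,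
        Int.add_mul_ediv_right _ _ hM0]
      ring
    rw [e1, torusSupNorm_translate]
  -- far sites are far blocks
  have hfar_of : ∀ y : Site (d + 1), (ℓ : ℝ) * (L ^ (k + 1) : ℕ) + (((L ^ (k + 1) : ℕ) : ℝ) - 1)
      ≤ torusSupNorm (fun _ : Fin (d + 1) => L ^ (k + 1) * N) (y - z) → ((ℓ : ℝ) ≤ torusSupNorm (fun _ : Fin (d + 1) => N) ((fun j => y j / ((L ^ (k + 1) : ℕ) : ℤ)) - c)) := by
    intro y hy
    rw [hc]
    exact le_tsn_block_of_le_fine (M := L ^ (k + 1)) (N := N) y z hy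
  have hgap : (ℓ : ℝ) * (L ^ (k + 1) : ℕ) + (((L ^ (k + 1) : ℕ) : ℝ) - 1) ≤ (ρ₁ : ℝ) - 2 * (L : ℝ) ^ (k + 1) := by
    rw [hMr, hρ₁r]
    have h1 : (0 : ℝ) ≤ (nbRad (d + 1) L : ℝ) * (L : ℝ) ^ (k + 1) := mul_nonneg hnb0 hMpos.le
    have h2 : (0 : ℝ) ≤ (ℓ : ℝ) * (L : ℝ) ^ (k + 1) := mul_nonneg (by positivity) hMpos.le
    have h3 : ((nbRad (d + 1) L : ℝ) + 2 * ℓ + 6) * (L : ℝ) ^ (k + 1) - 2 * (L : ℝ) ^ (k + 1)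
        - ((ℓ : ℝ) * (L : ℝ) ^ (k + 1) + ((L : ℝ) ^ (k + 1) - 1))
        = (nbRad (d + 1) L : ℝ) * (L : ℝ) ^ (k + 1) + (ℓ : ℝ) * (L : ℝ) ^ (k + 1) + 3 * (L : ℝ) ^ (k + 1) + 1 := by ring
    linarith [h1, h2, hMpos.le, h3]
  -- the variation zone of `χ` and its neighbours are far
  have hgS : ∀ (y : Site (d + 1)) (κ : Fin (d + 1)), χ (y + e κ) ≠ χ y → ((ℓ : ℝ) ≤ torusSupNorm (fun _ : Fin (d + 1) => N) ((fun j => y j / ((L ^ (k + 1) : ℕ) : ℤ)) - c)) ∧ ∀ lam : Fin (d + 1), ((ℓ : ℝ) ≤ torusSupNorm (fun _ : Fin (d + 1) => N) ((fun j => (y + e lam) j / ((L ^ (k + 1) : ℕ) : ℤ)) - c)) := by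
    intro y κ hne
    obtain ⟨hlo, -⟩ := hvar y κ hne
    refine ⟨hfar_of y (by linarith), fun lam => hfar_of (y + e lam) ?_⟩
    have := le_tsn_fine_add_e (L ^ (k + 1) * N) y z lam
    linarith
  -- level slabs: `χ` constant or far
  have hbox : ∀ (w : Site (d + 1)) (τ : Fin (d + 1)),
      (∃ g₀ : ℝ, ∀ y : Site (d + 1), (∀ i, (L : ℤ) ^ (k + 1) * w i ≤ y i ∧ y i ≤ (L : ℤ) ^ (k + 1) * w i + 2 * (L : ℤ) ^ (k + 1) - 1) → χ y = g₀) ∨ (∀ y : Site (d + 1), (∀ i, (L : ℤ) ^ (k + 1) * w i ≤ y i ∧ y i ≤ (L : ℤ) ^ (k + 1) * w i + 2 * (L : ℤ) ^ (k + 1) - 1) → ((ℓ : ℝ) ≤ torusSupNorm (fun _ : Fin (d + 1) => N) ((fun j => y j / ((L ^ (k + 1) : ℕ) : ℤ)) - c))) := by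
    intro w τ
    by_cases hall : ∀ y : Site (d + 1), (∀ i, (L : ℤ) ^ (k + 1) * w i ≤ y i ∧ y i ≤ (L : ℤ) ^ (k + 1) * w i + 2 * (L : ℤ) ^ (k + 1) - 1) → torusSupNorm (fun _ : Fin (d + 1) => L ^ (k + 1) * N) (y - z) ≤ ρ₁
    · exact Or.inl ⟨1, fun y hy => hplat y (hall y hy)⟩
    · push Not at hall
      obtain ⟨y₁, hy₁, hfar⟩ := hall
      refine Or.inr fun y hy => hfar_of y ?_
      have h := tsn_fine_le_of_slab (L ^ (k + 1) * N) (M := (L : ℤ) ^ (k + 1)) w y₁ y z hy₁ hy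
      push_cast at h
      linarith
  -- agreement on slabs meeting `supp χ` and on plaquettes meeting `supp χ`
  have hagreeQ : ∀ (w : Site (d + 1)) (τ : Fin (d + 1)), (∃ y₀ : Site (d + 1), (∀ i, (L : ℤ) ^ (k + 1) * w i ≤ y₀ i ∧ y₀ i ≤ (L : ℤ) ^ (k + 1) * w i + 2 * (L : ℤ) ^ (k + 1) - 1) ∧ χ y₀ ≠ 0) →
      ∀ (y : Site (d + 1)) (μ' : Fin (d + 1)), (∀ i, (L : ℤ) ^ (k + 1) * w i ≤ y i ∧ y i ≤ (L : ℤ) ^ (k + 1) * w i + 2 * (L : ℤ) ^ (k + 1) - 1) → U' y μ' = vary (flat (d := d + 1) (n := n)) At 1 y μ' := by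
    rintro w τ ⟨y₀, hy₀, hχy₀⟩ y μ' hy
    refine hagreeAt y μ' ?_
    have h0 := hχne y₀ hχy₀
    have h := tsn_fine_le_of_slab (L ^ (k + 1) * N) (M := (L : ℤ) ^ (k + 1)) w y y₀ z hy hy₀
    push_cast at h
    linarith
  have hagreeP : ∀ (y : Site (d + 1)) (μ' ν' : Fin (d + 1)), (χ y ≠ 0 ∨ χ (y + e μ') ≠ 0 ∨ χ (y + e ν') ≠ 0) →
      vary (flat (d := d + 1) (n := n)) At 1 y μ' = U' y μ' ∧ vary (flat (d := d + 1) (n := n)) At 1 (y + e μ') ν' = U' (y + e μ') ν' ∧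
      vary (flat (d := d + 1) (n := n)) At 1 (y + e ν') μ' = U' (y + e ν') μ' ∧ vary (flat (d := d + 1) (n := n)) At 1 y ν' = U' y ν' := by
    intro y μ' ν' hχ
    have hy : torusSupNorm (fun _ : Fin (d + 1) => L ^ (k + 1) * N) (y - z) < (ρ₁ : ℝ) + 2 * (L : ℝ) ^ (k + 1) := by
      rcases hχ with h | h | h
      · have := hχne y h; linarith
      · have := hχne _ h; have h2 := le_tsn_fine_add_e (L ^ (k + 1) * N) y z μ'; linarith
      · have := hχne _ h; have h2 := le_tsn_fine_add_e (L ^ (k + 1) * N) y z ν'; linarith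
    have hyμ := tsn_fine_add_e_le (L ^ (k + 1) * N) y z μ'
    have hyν := tsn_fine_add_e_le (L ^ (k + 1) * N) y z ν'
    have hM0 : (0 : ℝ) ≤ (L : ℝ) ^ (k + 1) := hMpos.le
    exact ⟨(hagreeAt y μ' (by linarith [hMge1])).symm, (hagreeAt _ ν' (by linarith [hMge1])).symm,
      (hagreeAt _ μ' (by linarith [hMge1])).symm, (hagreeAt y ν' (by linarith [hMge1])).symm⟩
  have hcurv : curvSum (d + 1) L (k + 1) 0 ≤ 2 / 3 * L := by rw [curvSum_zero]; positivity
  -- F275 at each straight test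
  have hC3 : ∀ Y : Site (d + 1) → Fin (d + 1) → Matrix n n ℂ, IsSkewDir Y → IsPeriodicDir Y ((L ^ (k + 1) * N : ℕ) : ℤ) →
      (Qcoarse L)^[k + 1] Y = 0 → _ :=
    fun Y hY hYP hYQ => abs_dAction_cutoffRep_le_twoRegion_straight (n := n) hL k hU'u hU'P hx0 hLS hU'ε hθ' hθl' hε1' ha0 hU'r hcrit' hAt hAtP'
      ha₀ ha₁ hAtα hAt1 (levelSmall_zero L (k + 1)) hcurv hσ hS1 hb χ hχP hχ01 hc₁0 hc₂0 hc1 hc2 (fun x : Site (d + 1) => (ℓ : ℝ) ≤ torusSupNorm (fun _ : Fin (d + 1) => N) ((fun j => x j / ((L ^ (k + 1) : ℕ) : ℤ)) - c)) hSP hgS hbox hagreeQ hagreeP hY hYP hYQ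
  /- §7 assembly -/
  -- assembly
  intro Y hY hYP hYQ
  rw [hmc] at hYP ⊢
  have h := hC3 Y hY hYP hYQ
  rw [hxM] at h
  -- the scaling identity `(M^(d+1)∕M²)·(L∕L^(d+1))^(k+1) = 1∕M`
  have hq : ((L : ℝ) / (L : ℝ) ^ (d + 1)) ^ (k + 1) = (L : ℝ) ^ (k + 1) / ((L : ℝ) ^ (k + 1)) ^ (d + 1) := by
    rw [div_pow, ← pow_mul, ← pow_mul, mul_comm (d + 1) (k + 1)]
  have hLpos : (0 : ℝ) < L := by exact_mod_cast (by omega : 0 < L)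
  obtain ⟨Kd8, hKd8⟩ : ∃ K : ℝ, K = (8 * (3 + 12 * ((d + 1 : ℕ) : ℝ)) * (2 + 2 * ((((d + 1 : ℕ) : ℝ) + 1) * L)
        * (1 + ((1250 * ((nbRad (d + 1) L : ℝ) + L) + 8 * (((d + 1 : ℕ) : ℝ) * L) + 2 * L) * (((d + 1 : ℕ) : ℝ) * (2 * nbRad (d + 1) L + 1) ^ (d + 1)))
          / ((L : ℝ) / (L : ℝ) ^ (d + 1))))) := ⟨_, rfl⟩
  obtain ⟨Cc, hCc⟩ : ∃ C : ℝ, C = curl1C (d + 1) L / (1 - thetaLoc (d + 1) L * ε) := ⟨_, rfl⟩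
  obtain ⟨ρa, hρa⟩ : ∃ C : ℝ, C = ((Fintype.card (T4AveragingDeficitWall.Plane (d + 1)) : ℝ)
        * (2 * (8 * a₀ * (2 * a₁ + 28 * a₀ ^ 2) + 6 * (Real.exp a₀ - 1) * (2 * a₁ + 24 * (Real.exp a₀ - 1) * a₀)
            + (2 * a₁ + 24 * (Real.exp a₀ - 1) * a₀) * (2 * a₁ + 28 * a₀ ^ 2) + 960 * (Real.exp a₀ - 1) * a₀ ^ 2)
          + 64 * a₀ * a₁)) := ⟨_, rfl⟩
  obtain ⟨ρb, hρb⟩ : ∃ C : ℝ, C = ((Fintype.card (T4AveragingDeficitWall.Plane (d + 1)) : ℝ)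
        * (2 * (8 * a₀ * (2 * (a₁ + 1 / (L : ℝ) ^ (k + 1) * a₀) + 28 * a₀ ^ 2) + 6 * (Real.exp a₀ - 1) * (2 * (a₁ + 1 / (L : ℝ) ^ (k + 1) * a₀) + 24 * (Real.exp a₀ - 1) * a₀)
            + (2 * (a₁ + 1 / (L : ℝ) ^ (k + 1) * a₀) + 24 * (Real.exp a₀ - 1) * a₀) * (2 * (a₁ + 1 / (L : ℝ) ^ (k + 1) * a₀) + 28 * a₀ ^ 2) + 960 * (Real.exp a₀ - 1) * a₀ ^ 2)
          + 64 * a₀ * (a₁ + 1 / (L : ℝ) ^ (k + 1) * a₀))) := ⟨_, rfl⟩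
  rw [← hKd8, ← hCc, ← hρa, ← hρb] at h
  rw [← hKd8, ← hCc, ← hρa, ← hρb]
  have e1 : r / ((L : ℝ) ^ (k + 1)) ^ 2 * (Cc * (((L : ℝ) ^ (k + 1)) ^ (d + 1) / ((L : ℝ) ^ (k + 1)) ^ 2))
      * (2 * (Kd8 * ((L : ℝ) ^ (k + 1) * a₀)) * ((L : ℝ) / (L : ℝ) ^ (d + 1)) ^ (k + 1))
      = r * ((L : ℝ) ^ (k + 1) * a₀) * (Cc * (2 * Kd8)) / ((L : ℝ) ^ (k + 1)) ^ 3 := by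
    rw [hq]; field_simp
  have e2 : r / ((L : ℝ) ^ (k + 1)) ^ 2 * (Cc * (((L : ℝ) ^ (k + 1)) ^ (d + 1) / ((L : ℝ) ^ (k + 1)) ^ 2)) * ((L : ℝ) / (L : ℝ) ^ (d + 1)) ^ (k + 1)
      = r * Cc / ((L : ℝ) ^ (k + 1)) ^ 3 := by
    rw [hq]; field_simp
  have hn0 : 0 ≤ dirL1 Y ((periodBox (d := d + 1) (L ^ (k + 1) * N)).filter (fun x => ¬ ((ℓ : ℝ) ≤ torusSupNorm (fun _ : Fin (d + 1) => N) ((fun j => x j / ((L ^ (k + 1) : ℕ) : ℤ)) - c)))) :=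
    Finset.sum_nonneg fun _ _ => Finset.sum_nonneg fun _ _ => norm_nonneg _
  have hf0 : 0 ≤ dirL1 Y ((periodBox (d := d + 1) (L ^ (k + 1) * N)).filter (fun x => ((ℓ : ℝ) ≤ torusSupNorm (fun _ : Fin (d + 1) => N) ((fun j => x j / ((L ^ (k + 1) : ℕ) : ℤ)) - c)))) :=
    Finset.sum_nonneg fun _ _ => Finset.sum_nonneg fun _ _ => norm_nonneg _
  refine h.trans (add_le_add (mul_le_mul_of_nonneg_right (le_of_eq ?_) hn0) (mul_le_mul_of_nonneg_right (le_of_eq ?_) hf0))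
  · rw [e1]
  · rw [e1, e2]



end

end Summit.QuantumFields.BalabanUV.T4Continuum.NE7TorusRoadDefectClause
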